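import Literature.MathematicalPhysics.KineticTheory.LanfordGCHierarchy
import HarnessLib

/-!
# Countable additivity of Duhamel terms in the data, and the canonical versus grand-canonical
# Duhamel terms (Lanford's theorem, the BBGKY side: tools for the grand-canonical resummation)

(Topic MathematicalPhysics/KineticTheory; tools for layer L2b of the bottom-up proof plan of the
named fact `Literature.MathematicalPhysics.KineticTheory.lanford` — **hilbert6.S02**, Lanford's
theorem for hard spheres on `T^d`, `Literature/MathematicalPhysics/KineticTheory/Sweep1.lean`.
Theorems only: no definition, no named fact.)

The rescaled correlation functions of a grand-canonical state are the series
`F^{(s)} = μ^{-s} ∑_p (p!)⁻¹ f^{(s)}_{s+p}` of the marginals of its sectors (`Kinetic.correlationFn`,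
BGSS 2023 (1.1.6)); the grand-canonical BBGKY hierarchy (BGSS 2023 (1.1.7)–(1.1.8)) is obtained from
the `N`-particle hierarchies of the sectors (GST 2013 (4.3.5)–(4.3.9), CIP 1994 (4.7)) by summing over
the sectors, which turns the canonical prefactors `(N - s) ε^{d-1}` into the activity
`μ_ε ε^{d-1} = 1`. To carry this resummation over to the iterated Duhamel terms one needs two
facts, proved here:

* `duhamelTerm_hsHierarchyModel_eq_prod_mul` (§1) — **canonical versus grand-canonical Duhamel
  terms**: the `N`-sphere model `hsHierarchyModel hε hε' N` (`HardSphereHierarchyModel`) and the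
  grand-canonical model `gcHierarchyModel hε'` (`LanfordGCHierarchy`) have the same transports and
  proportional collision operators, `C^{out,N}_{k,k+1} = ((N - k) ε^{d-1}) • C^{gc,out}_{k,k+1}`
  (`outBbgkyOp_eq_smul_gcOutOp`), hence
  `Q^{N}_{s,s+m}(t) = (∏_{j<m} (N - s - j) ε^{d-1}) · Q^{gc}_{s,s+m}(t)` on every family
  (homogeneity only; for `N = s + p` the product is `ε^{m(d-1)} p!/(p-m)!`, and it vanishes for
  `m > p`).
* `hasSum_hsCollisionTerm`, `hasSum_gcOutOp` (§2) — **countable additivity of the hard-sphere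
  collision term and of the grand-canonical collision operator** on series of measurable densities
  with summable Gaussian majorants `|u_j| ≤ K_j e^{-b E}`, `∑ K_j < ∞` (dominated convergence in the
  velocity and impact-direction integrals).
* `HierarchyModel.hasSum_duhamelTerm` (§3) — **countable additivity of the iterated Duhamel terms
  in the data**, for an abstract hierarchy model whose collision operators are countably additive
  in the above sense (hypothesis `hop`; `gcHierarchyModel` qualifies, `hasSum_duhamelTerm_gc`): if
  `G = ∑_j G_j` level-wise with majorants `|G_j^{(k)}| ≤ B_{j,k} e^{-β E}`, `∑_j B_{j,k} < ∞`, then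
  `Q_{s,s+m}(t) G = ∑_j Q_{s,s+m}(t) G_j` pointwise (`t ≥ 0`) — induction on `m`: the chain estimate
  `abs_hierarchyChain_le` bounds the inner terms uniformly on `[0, t]` by summable constants, the
  collision operator is passed through the series by `hop`, the time integral by dominated
  convergence (`intervalIntegral.hasSum_integral_of_dominated_convergence`).

## References

* C. Cercignani, R. Illner, M. Pulvirenti, *The Mathematical Theory of Dilute Gases*, Applied
  Mathematical Sciences 106, Springer (1994), §4.4 (4.7) (the BBGKY series), Thm 4.4.1 Step 3
  (bib key `CIP1994`).
* T. Bodineau, I. Gallagher, L. Saint-Raymond, S. Simonella, Ann. Math. 198 (2023) =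
  arXiv:2008.10403, §1.1 (1.1.6)–(1.1.8) (bib key `BGSS2023`).
* I. Gallagher, L. Saint-Raymond, B. Texier, *From Newton to Boltzmann* (2013) = arXiv:1208.5753,
  (4.3.5)–(4.3.9) (bib key `GST2013`).
-/

open MeasureTheory Metric Real Set Filter Topology Function
open scoped ENNReal Nat InnerProductSpace

namespace Literature.MathematicalPhysics.KineticTheory

noncomputable section

open Literature.Analysis.FluidPDE

variable {d : Type*} [Fintype d]

/-! ## §1. Canonical versus grand-canonical Duhamel terms -/

section Scaling

variable {ε : ℝ} (hε : 0 < ε) (hε' : ε < 2⁻¹) (N : ℕ)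

/-- **The Duhamel terms of the `N`-sphere model are those of the grand-canonical model times the
product of the canonical prefactors**: for every family `F₀`, level `s`, order `m`, time `t`,
`Q^{N}_{s,s+m}(t) F₀ = (∏_{j<m} (N - (s + j)) ε^{d-1}) · Q^{gc}_{s,s+m}(t) F₀` (same transports —
the regularised Alexander flows —, `C^{out,N}_{k,k+1} = ((N - k) ε^{d-1}) • C^{gc,out}_{k,k+1}`,
homogeneity of the Duhamel recursion). `ℕ`-subtraction: the factor `N - (s + j)` vanishes for
`s + j ≥ N`, as the canonical hierarchy stops at `N` particles. [cite: GST2013, (4.3.5)–(4.3.9)] -/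
theorem duhamelTerm_hsHierarchyModel_eq_prod_mul (m : ℕ) :
    ∀ (s : ℕ) (t : ℝ) (F₀ : GCState d (UnitAddTorus d)) (Z : Config s d (UnitAddTorus d)),
      duhamelTerm (hsHierarchyModel (d := d) hε hε' N).transport (hsHierarchyModel hε hε' N).op m s t F₀ Z =
        (∏ j ∈ Finset.range m, (((N - (s + j) : ℕ) : ℝ) * ε ^ (Fintype.card d - 1))) *
          duhamelTerm (gcHierarchyModel (d := d) hε').transport (gcHierarchyModel hε').op m s t F₀ Z := by
  induction m with
  | zero =>
    intro s t F₀ Z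
    simp only [duhamelTerm_zero, Finset.range_zero, Finset.prod_empty, one_mul]
    rfl
  | succ m ih =>
    intro s t F₀ Z
    rw [duhamelTerm_succ, duhamelTerm_succ, Finset.prod_range_succ', ← intervalIntegral.integral_const_mul]
    refine intervalIntegral.integral_congr fun τ _ => ?_
    simp only [HierarchyModel.transport_apply, hsHierarchyModel_flow, gcHierarchyModel_flow,
      hsHierarchyModel_op, gcHierarchyModel_op, Nat.add_zero]
    -- the inner terms are proportional, as functions
    have hfun : duhamelTerm (hsHierarchyModel (d := d) hε hε' N).transport (hsHierarchyModel hε hε' N).op m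
        (s + 1) τ F₀ =
        (∏ j ∈ Finset.range m, (((N - (s + 1 + j) : ℕ) : ℝ) * ε ^ (Fintype.card d - 1))) •
          duhamelTerm (gcHierarchyModel (d := d) hε').transport (gcHierarchyModel hε').op m (s + 1) τ F₀ := by
      funext W
      rw [Pi.smul_apply, smul_eq_mul]
      exact ih (s + 1) τ F₀ W
    rw [hfun, outBbgkyOp_smul, outBbgkyOp_eq_smul_gcOutOp]
    simp only [Pi.smul_apply, smul_eq_mul]
    have hprod : ∏ j ∈ Finset.range m, (((N - (s + (j + 1)) : ℕ) : ℝ) * ε ^ (Fintype.card d - 1)) =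
        ∏ j ∈ Finset.range m, (((N - (s + 1 + j) : ℕ) : ℝ) * ε ^ (Fintype.card d - 1)) :=
      Finset.prod_congr rfl fun j _ => by rw [show s + (j + 1) = s + 1 + j by omega]
    rw [hprod]
    ring

/-- In particular for the sector `N = s + p`: the prefactor of order `m ≤ p` is
`ε^{m(d-1)} p!/(p-m)!` — here in the product form `∏_{j<m} (p - j) ε^{d-1}` — and the Duhamel
terms of order `m > p` vanish. [folklore] -/
theorem duhamelTerm_hsHierarchyModel_sector (s p m : ℕ) (t : ℝ) (F₀ : GCState d (UnitAddTorus d))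
    (Z : Config s d (UnitAddTorus d)) :
    duhamelTerm (hsHierarchyModel (d := d) hε hε' (s + p)).transport (hsHierarchyModel hε hε' (s + p)).op m s t F₀ Z =
      (∏ j ∈ Finset.range m, (((p - j : ℕ) : ℝ) * ε ^ (Fintype.card d - 1))) *
        duhamelTerm (gcHierarchyModel (d := d) hε').transport (gcHierarchyModel hε').op m s t F₀ Z := by
  have hprod : ∏ j ∈ Finset.range m, (((s + p - (s + j) : ℕ) : ℝ) * ε ^ (Fintype.card d - 1)) =
      ∏ j ∈ Finset.range m, (((p - j : ℕ) : ℝ) * ε ^ (Fintype.card d - 1)) :=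
    Finset.prod_congr rfl fun j _ => by rw [show s + p - (s + j) = p - j by omega]
  rw [duhamelTerm_hsHierarchyModel_eq_prod_mul hε hε' (s + p) m s t F₀ Z, hprod]

/-- The prefactor of order `m > p` in the sector `s + p` vanishes. [folklore] -/
theorem prod_range_sub_eq_zero_of_lt {p m : ℕ} (h : p < m) (c : ℝ) :
    ∏ j ∈ Finset.range m, (((p - j : ℕ) : ℝ) * c) = 0 := by
  refine Finset.prod_eq_zero (i := p) (Finset.mem_range.2 h) ?_
  simp

/-- The prefactor of order `m ≤ p` in the sector `s + p` is `c^m p!/(p-m)!`: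
`∏_{j<m} (p - j) c = c^m · p!/(p - m)!` (descending factorial). [folklore] -/
theorem prod_range_sub_eq_descFactorial (p m : ℕ) (c : ℝ) :
    ∏ j ∈ Finset.range m, (((p - j : ℕ) : ℝ) * c) = c ^ m * (p.descFactorial m : ℝ) := by
  rw [Finset.prod_mul_distrib, Finset.prod_const, Finset.card_range, mul_comm]
  congr 1
  rw [Nat.descFactorial_eq_prod_range, Nat.cast_prod]

end Scaling

/-! ## §2. Countable additivity of the collision operators -/

section OpSum

variable {X : Type*} [MeasurableSpace X] {G : Geometry d X} {s : ℕ}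

/-- **Countable additivity of the hard-sphere collision term**: for measurable densities `u_j` with
Gaussian majorants `|u_j| ≤ K_j e^{-b E}` and `∑_j K_j < ∞`,
`C^i_{s,s+1}[∑_j u_j] = ∑_j C^i_{s,s+1}[u_j]` at every configuration (dominated convergence in the
velocity integral, then in the impact-direction integral; the integrand is dominated by
`K_j (1 + |v_i|) e^{-b E(Z_s)} (1 + |v|) e^{-(b/2)|v|²}`, `abs_hsCollisionIntegrand_le`). [folklore] -/
theorem hasSum_hsCollisionTerm (hG : Measurable fun p : X × EuclideanSpace ℝ d => G.translate p.1 p.2)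
    (ε : ℝ) (i : Fin s) {u : ℕ → Config (s + 1) d X → ℝ} {K : ℕ → ℝ} {b : ℝ} (hb : 0 < b)
    (hum : ∀ j, Measurable (u j)) (hK0 : ∀ j, 0 ≤ K j)
    (hub : ∀ j Z, |u j Z| ≤ K j * exp (-b * configEnergy Z)) (hK : Summable K) (Zs : Config s d X) :
    HasSum (fun j => hsCollisionTerm G ε s i (u j) Zs)
      (hsCollisionTerm G ε s i (fun Z => ∑' j, u j Z) Zs) := by
  haveI := isFiniteMeasure_sphereMeasure (E := EuclideanSpace ℝ d)
  -- the sum and its bounds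
  have hsum : ∀ Z, Summable fun j => u j Z := fun Z =>
    Summable.of_norm_bounded (g := fun j => K j * exp (-b * configEnergy Z)) (hK.mul_right _)
      fun j => by rw [Real.norm_eq_abs]; exact hub j Z
  have hUb : ∀ Z, |∑' j, u j Z| ≤ (∑' j, K j) * exp (-b * configEnergy Z) := by
    intro Z
    rw [← tsum_mul_right]
    calc |∑' j, u j Z| = ‖∑' j, u j Z‖ := (Real.norm_eq_abs _).symm
      _ ≤ ∑' j, ‖u j Z‖ := norm_tsum_le_tsum_norm (hsum Z).norm
      _ ≤ ∑' j, K j * exp (-b * configEnergy Z) :=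
          Summable.tsum_le_tsum (fun j => by rw [Real.norm_eq_abs]; exact hub j Z) (hsum Z).norm
            (hK.mul_right _)
  have hUm : Measurable fun Z => ∑' j, u j Z := Measurable.tsum hum
  -- notation for the integrand
  obtain ⟨I, hI⟩ : ∃ I : (Config (s + 1) d X → ℝ) → sphere (0 : EuclideanSpace ℝ d) 1 → EuclideanSpace ℝ d → ℝ,
      I = fun (g : Config (s + 1) d X → ℝ) (ω : sphere (0 : EuclideanSpace ℝ d) 1) (v : EuclideanSpace ℝ d) =>
        max ⟪(ω : EuclideanSpace ℝ d), v - (Zs i).2⟫_ℝ 0 * g (gainConfig G ε Zs i ω v) -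
          max (-⟪(ω : EuclideanSpace ℝ d), v - (Zs i).2⟫_ℝ) 0 * g (lossConfig G ε Zs i ω v) := ⟨_, rfl⟩
  obtain ⟨ψ, hψ⟩ : ∃ ψ : EuclideanSpace ℝ d → ℝ, ψ = fun v => (1 + ‖v‖) * exp (-(b / 2) * ‖v‖ ^ 2) :=
    ⟨_, rfl⟩
  have hψi : Integrable ψ := by rw [hψ]; exact integrable_one_add_norm_mul_exp (E := EuclideanSpace ℝ d) hb
  obtain ⟨c, hc⟩ : ∃ c : ℕ → ℝ, c = fun j => K j * (1 + ‖(Zs i).2‖) * exp (-b * configEnergy Zs) := ⟨_, rfl⟩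
  have hc0 : ∀ j, 0 ≤ c j := fun j => by rw [hc]; have := hK0 j; positivity
  have hcs : Summable c := by
    rw [hc]
    exact (hK.mul_right _).mul_right _
  -- pointwise: the integrand is countably additive in the density
  have hptw : ∀ ω v, HasSum (fun j => I (u j) ω v) (I (fun Z => ∑' j, u j Z) ω v) := by
    intro ω v
    rw [hI]
    exact (((hsum _).hasSum).mul_left _).sub (((hsum _).hasSum).mul_left _)
  have hIb : ∀ j ω v, ‖I (u j) ω v‖ ≤ c j * ψ v := fun j ω v => by
    rw [Real.norm_eq_abs, hI, hc, hψ]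
    exact abs_hsCollisionIntegrand_le G ε i (hub j) Zs ω v
  have hIm : ∀ j ω, AEStronglyMeasurable (I (u j) ω) volume := fun j ω => by
    rw [hI]
    exact (integrable_hsCollisionIntegrand hG ε i hb (hum j) (hub j) Zs ω).aestronglyMeasurable
  -- the velocity integral, for every impact direction
  have hinner : ∀ ω, HasSum (fun j => ∫ v, I (u j) ω v) (∫ v, I (fun Z => ∑' j, u j Z) ω v) := by
    intro ω
    refine hasSum_integral_of_dominated_convergence (fun j v => c j * ψ v) (hIm · ω)
      (fun j => Eventually.of_forall fun v => hIb j ω v) ?_ ?_ ?_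
    · exact Eventually.of_forall fun v => (hcs.mul_right _)
    · have : (fun v => ∑' j, c j * ψ v) = fun v => (∑' j, c j) * ψ v := funext fun v => tsum_mul_right
      rw [this]
      exact hψi.const_mul _
    · exact Eventually.of_forall fun v => hptw ω v
  -- the impact-direction integral
  have hJb : ∀ j ω, ‖∫ v, I (u j) ω v‖ ≤ c j * ∫ v, ψ v := fun j ω => by
    calc ‖∫ v, I (u j) ω v‖ ≤ ∫ v, c j * ψ v :=
          norm_integral_le_of_norm_le (hψi.const_mul _) (Eventually.of_forall fun v => hIb j ω v)
      _ = c j * ∫ v, ψ v := integral_const_mul _ _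
  have hJm : ∀ j, AEStronglyMeasurable (fun ω => ∫ v, I (u j) ω v)
      (KineticTheory.sphereMeasure : Measure (sphere (0 : EuclideanSpace ℝ d) 1)) := fun j => by
    rw [hI]
    exact (integrable_integral_hsCollisionIntegrand hG ε i hb (hum j) (hub j) Zs).aestronglyMeasurable
  have houter : HasSum (fun j => ∫ ω, (∫ v, I (u j) ω v) ∂KineticTheory.sphereMeasure)
      (∫ ω, (∫ v, I (fun Z => ∑' j, u j Z) ω v) ∂KineticTheory.sphereMeasure) := by
    refine hasSum_integral_of_dominated_convergence (fun j _ => c j * ∫ v, ψ v) hJm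
      (fun j => Eventually.of_forall fun ω => hJb j ω) ?_ ?_ ?_
    · exact Eventually.of_forall fun ω => hcs.mul_right _
    · exact integrable_const _
    · exact Eventually.of_forall hinner
  have hunf : ∀ g : Config (s + 1) d X → ℝ,
      hsCollisionTerm G ε s i g Zs = ∫ ω, (∫ v, I g ω v) ∂KineticTheory.sphereMeasure := fun g => by
    rw [hI]; rfl
  simpa only [hunf] using houter

/-- **Countable additivity of the grand-canonical collision operator** `C^{gc,out}_{s,s+1}`
(`gcOutOp`) on series of measurable densities with summable Gaussian majorants (the compositions
with the outgoing representatives keep measurability and the majorants). [folklore] -/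
theorem hasSum_gcOutOp (hGm : G.IsMeasurable) (ε : ℝ) {u : ℕ → Config (s + 1) d X → ℝ}
    {K : ℕ → ℝ} {b : ℝ} (hb : 0 < b) (hum : ∀ j, Measurable (u j)) (hK0 : ∀ j, 0 ≤ K j)
    (hub : ∀ j Z, |u j Z| ≤ K j * exp (-b * configEnergy Z)) (hK : Summable K) (Zs : Config s d X) :
    HasSum (fun j => gcOutOp G ε s (u j) Zs) (gcOutOp G ε s (fun Z => ∑' j, u j Z) Zs) := by
  unfold gcOutOp
  refine hasSum_sum fun i _ => ?_
  have h := hasSum_hsCollisionTerm hGm.measurable_translate ε i (u := fun j => u j ∘ outRep G s i) hb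
    (fun j => (hum j).comp (measurable_outRep hGm s i)) hK0 (fun j Z => abs_comp_outRep_le i (hub j) Z)
    hK Zs
  exact h

end OpSum

/-! ## §3. Countable additivity of the Duhamel terms in the data -/

section TermSum

variable {X : Type*} [MeasurableSpace X]

/-- **Countable additivity of the iterated Duhamel terms in the data.** Let `M` be a hierarchy
model whose collision operators are countably additive on series of measurable densities with
summable Gaussian majorants (hypothesis `hop`; e.g. `gcHierarchyModel`, `hasSum_gcOutOp`). Let
`G_j` (`j ∈ ℕ`) be families of measurable functions with `|G_j^{(k)}| ≤ B_{j,k} e^{-β E}`,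
`B_{j,k} ≥ 0`, `∑_j B_{j,k} < ∞` for every level `k` (`β > 0`). Then for all `m, s`, `t ≥ 0` and `Z_s`,
`Q_{s,s+m}(t)[∑_j G_j] (Z_s) = ∑_j Q_{s,s+m}(t)[G_j] (Z_s)` (the series of the data taken
level-wise and pointwise). Induction on `m`: the inner terms `Q_{s+1,s+1+m}(τ) G_j` are measurable
(`isNice_duhamelTerm`) and bounded on `[0, t]` by `e^{s} (C'_M t/(√β)^{d+1})^m B_{j,s+1+m} e^{-(β/2)E}`
(`abs_hierarchyChain_le`), summable in `j`; `hop` passes the collision operator through the series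
and dominated convergence (`intervalIntegral.hasSum_integral_of_dominated_convergence`, with the
constant majorants given by `HierarchyModel.abs_op_le`) the time integral. [folklore] -/
theorem HierarchyModel.hasSum_duhamelTerm (M : HierarchyModel d X)
    (hop : ∀ (s : ℕ) (u : ℕ → Config (s + 1) d X → ℝ) (K : ℕ → ℝ) (b : ℝ), 0 < b →
      (∀ j, Measurable (u j)) → (∀ j, 0 ≤ K j) →
      (∀ j Z, |u j Z| ≤ K j * exp (-b * configEnergy Z)) → Summable K →
      ∀ Zs, HasSum (fun j => M.op s (u j) Zs) (M.op s (fun Z => ∑' j, u j Z) Zs))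
    {G : ℕ → GCState d X} (hGm : ∀ j k, Measurable (G j k)) {B : ℕ → ℕ → ℝ} {β : ℝ} (hβ : 0 < β)
    (hB0 : ∀ j k, 0 ≤ B j k) (hGb : ∀ j k Z, |G j k Z| ≤ B j k * exp (-β * configEnergy Z))
    (hBs : ∀ k, Summable fun j => B j k) (m : ℕ) :
    ∀ (s : ℕ) {t : ℝ} (_ht : 0 ≤ t) (Z : Config s d X),
      HasSum (fun j => duhamelTerm M.transport M.op m s t (G j) Z)
        (duhamelTerm M.transport M.op m s t (fun k W => ∑' j, G j k W) Z) := by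
  -- level-wise summability of the data
  have hsum : ∀ k W, Summable fun j => G j k W := fun k W =>
    Summable.of_norm_bounded (g := fun j => B j k * exp (-β * configEnergy W)) ((hBs k).mul_right _)
      fun j => by rw [Real.norm_eq_abs]; exact hGb j k W
  induction m with
  | zero =>
    intro s t _ Z
    simp only [duhamelTerm_zero, HierarchyModel.transport_apply]
    exact (hsum s _).hasSum
  | succ m ih =>
    intro s t ht Z
    have hnice : ∀ j k, IsNice (G j k) := fun j k => ⟨hGm j k, B j k, β, hβ, hGb j k⟩
    -- the inner terms and their sum
    obtain ⟨u, hu⟩ : ∃ u : ℕ → ℝ → Config (s + 1) d X → ℝ,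
        u = fun j τ => duhamelTerm M.transport M.op m (s + 1) τ (G j) := ⟨_, rfl⟩
    obtain ⟨U, hU⟩ : ∃ U : ℝ → Config (s + 1) d X → ℝ,
        U = fun τ => duhamelTerm M.transport M.op m (s + 1) τ (fun k W => ∑' j, G j k W) := ⟨_, rfl⟩
    have hUsum : ∀ τ, 0 ≤ τ → (fun W => ∑' j, u j τ W) = U τ := by
      intro τ hτ
      funext W
      rw [hu, hU]
      exact (ih (s + 1) hτ W).tsum_eq
    -- measurability of the inner terms
    have hum : ∀ j τ, 0 ≤ τ → Measurable (u j τ) := fun j τ hτ => by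
      rw [hu]
      exact (isNice_duhamelTerm M (hnice j) m (s + 1) hτ).1
    -- uniform bounds on `[0, t]`: `|u j τ W| ≤ K j * e^{-(β/2) E}`
    obtain ⟨Cst, hCst⟩ : ∃ Cst : ℝ,
        Cst = (exp 2 * sqrt 2 ^ (Fintype.card d + 3) * M.opConst + 1) * t / sqrt β ^ (Fintype.card d + 1) :=
      ⟨_, rfl⟩
    have hCst0 : 0 ≤ Cst := by
      have := M.opConst_nonneg
      rw [hCst]; positivity
    obtain ⟨K, hK⟩ : ∃ K : ℕ → ℝ, K = fun j => (exp (s + 1 : ℝ) * Cst ^ m + 1) * B j (s + 1 + m) := ⟨_, rfl⟩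
    have hK0 : ∀ j, 0 ≤ K j := fun j => by rw [hK]; have := hB0 j (s + 1 + m); positivity
    have hKs : Summable K := by rw [hK]; exact (hBs (s + 1 + m)).mul_left _
    have hub : ∀ j, ∀ τ ∈ Icc 0 t, ∀ W, |u j τ W| ≤ K j * exp (-(β / 2) * configEnergy W) := by
      intro j τ hτ W
      have hE : 0 ≤ configEnergy W := configEnergy_nonneg' W
      have hE2 : exp (-β * configEnergy W) ≤ exp (-(β / 2) * configEnergy W) := exp_le_exp.2 (by nlinarith)
      have hBle : B j (s + 1 + m) * exp (-(β / 2) * configEnergy W) ≤ K j * exp (-(β / 2) * configEnergy W) := by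
        rw [hK]
        refine mul_le_mul_of_nonneg_right ?_ (exp_pos _).le
        have h1 : 0 ≤ exp (s + 1 : ℝ) * Cst ^ m := by positivity
        have := hB0 j (s + 1 + m)
        nlinarith
      rcases Nat.eq_zero_or_pos m with hm | hm
      · subst hm
        rw [hu]
        simp only [duhamelTerm_zero, HierarchyModel.transport_apply]
        rw [← M.configEnergy_flow (s + 1) (-τ) W] at hE2 hBle ⊢
        have h := hGb j (s + 1) (M.flow (s + 1) (-τ) W)
        simp only [Nat.add_zero] at hBle
        exact (h.trans (mul_le_mul_of_nonneg_left hE2 (hB0 _ _))).trans hBle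
      · have h := abs_hierarchyChain_le M (fun n k τ' => duhamelTerm M.transport M.op n k τ' (G j))
          (fun n k τ' W' => duhamelTerm_succ _ _ n k τ' _ W') ht hβ (s + 1) m hm (hB0 j (s + 1 + m))
          (fun τ' _ W' => by
            rw [duhamelTerm_zero, HierarchyModel.transport_apply, ← M.configEnergy_flow (s + 1 + m) (-τ') W']
            exact hGb j (s + 1 + m) _) hτ W
        rw [hu]
        refine h.trans ?_
        have hτt : ((exp 2 * sqrt 2 ^ (Fintype.card d + 3) * M.opConst + 1) * τ /
            sqrt β ^ (Fintype.card d + 1)) ^ m ≤ Cst ^ m := by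
          have hA := M.opConst_nonneg
          have hτ0 := hτ.1
          refine pow_le_pow_left₀ (by positivity) ?_ m
          rw [hCst]
          have hsβ : 0 < sqrt β ^ (Fintype.card d + 1) := pow_pos (sqrt_pos.2 hβ) _
          exact div_le_div_of_nonneg_right (mul_le_mul_of_nonneg_left hτ.2 (by positivity)) hsβ.le
        have hs1 : ((s + 1 : ℕ) : ℝ) - 1 = (s : ℝ) := by push_cast; ring
        rw [hs1]
        calc exp (s : ℝ) * ((exp 2 * sqrt 2 ^ (Fintype.card d + 3) * M.opConst + 1) * τ /
              sqrt β ^ (Fintype.card d + 1)) ^ m * B j (s + 1 + m) * exp (-(β / 2) * configEnergy W)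
            ≤ exp (s : ℝ) * Cst ^ m * B j (s + 1 + m) * exp (-(β / 2) * configEnergy W) := by
              have := hB0 j (s + 1 + m)
              gcongr
          _ ≤ K j * exp (-(β / 2) * configEnergy W) := by
              rw [hK]
              refine mul_le_mul_of_nonneg_right ?_ (exp_pos _).le
              have h1 : exp (s : ℝ) ≤ exp (s + 1 : ℝ) := exp_le_exp.2 (by linarith)
              have h2 : 0 ≤ Cst ^ m := by positivity
              have h3 := hB0 j (s + 1 + m)
              nlinarith [mul_le_mul_of_nonneg_right h1 h2]
    -- the collision operator passes through the series, for `τ ∈ [0, t]`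
    have hopτ : ∀ τ ∈ Icc 0 t, ∀ Zs : Config s d X,
        HasSum (fun j => M.op s (u j τ) Zs) (M.op s (U τ) Zs) := by
      intro τ hτ Zs
      rw [← hUsum τ hτ.1]
      exact hop s (fun j => u j τ) K (β / 2) (half_pos hβ) (fun j => hum j τ hτ.1) hK0
        (fun j W => hub j τ hτ W) hKs Zs
    -- the integrands of the Duhamel step and their constant majorants
    obtain ⟨A, hA⟩ : ∃ A : ℝ,
        A = M.opConst * (sqrt (β / 2) ^ Fintype.card d)⁻¹ * (s * (sqrt (β / 2))⁻¹ + sqrt (s / (β / 2 / 2))) :=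
      ⟨_, rfl⟩
    have hA0 : 0 ≤ A := by have := M.opConst_nonneg; rw [hA]; positivity
    have hφb : ∀ j, ∀ τ ∈ Icc 0 t, |M.transport s (t - τ) (M.op s (u j τ)) Z| ≤ A * K j := by
      intro j τ hτ
      rw [M.transport_apply]
      have h := M.abs_op_le s (half_pos hβ) (hK0 j) (hub j τ hτ) (M.flow s (-(t - τ)) Z)
      refine h.trans ?_
      rw [hA]
      have hle : exp (-(β / 2 / 2) * configEnergy (M.flow s (-(t - τ)) Z)) ≤ 1 := by
        rw [exp_le_one_iff]
        have := configEnergy_nonneg' (M.flow s (-(t - τ)) Z)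
        nlinarith
      have := M.opConst_nonneg
      have hK0j := hK0 j
      calc M.opConst * (sqrt (β / 2) ^ Fintype.card d)⁻¹ * (s * (sqrt (β / 2))⁻¹ + sqrt (s / (β / 2 / 2))) *
            K j * exp (-(β / 2 / 2) * configEnergy (M.flow s (-(t - τ)) Z))
          ≤ M.opConst * (sqrt (β / 2) ^ Fintype.card d)⁻¹ * (s * (sqrt (β / 2))⁻¹ + sqrt (s / (β / 2 / 2))) *
            K j * 1 := by gcongr
        _ = _ := by ring
    have hφm : ∀ j, AEStronglyMeasurable (fun τ => M.transport s (t - τ) (M.op s (u j τ)) Z)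
        (volume.restrict (uIoc 0 t)) := by
      intro j
      have hniceT : IsNiceT t (u j) := by
        rw [hu]
        exact isNiceT_duhamelTerm M (hnice j) m (s + 1)
      have h2 : Measurable fun τ : ℝ => ((t, Z), τ) := measurable_const.prodMk measurable_id
      exact ((measurable_duhamelIntegrand M hniceT.measurable).comp h2).aestronglyMeasurable
    -- dominated convergence in the time integral
    have hstep : HasSum (fun j => ∫ τ in (0 : ℝ)..t, M.transport s (t - τ) (M.op s (u j τ)) Z)
        (∫ τ in (0 : ℝ)..t, M.transport s (t - τ) (M.op s (U τ)) Z) := by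
      refine intervalIntegral.hasSum_integral_of_dominated_convergence (fun j _ => A * K j) hφm ?_ ?_ ?_ ?_
      · intro j
        refine Eventually.of_forall fun τ hτ => ?_
        rw [uIoc_of_le ht] at hτ
        rw [Real.norm_eq_abs]
        exact hφb j τ ⟨hτ.1.le, hτ.2⟩
      · exact Eventually.of_forall fun τ _ => hKs.mul_left A
      · exact intervalIntegrable_const
      · refine Eventually.of_forall fun τ hτ => ?_
        rw [uIoc_of_le ht] at hτ
        simp only [M.transport_apply]
        exact hopτ τ ⟨hτ.1.le, hτ.2⟩ _
    -- conclusion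
    have hL : ∀ j, duhamelTerm M.transport M.op (m + 1) s t (G j) Z =
        ∫ τ in (0 : ℝ)..t, M.transport s (t - τ) (M.op s (u j τ)) Z := fun j => by
      rw [duhamelTerm_succ, hu]
    have hR : duhamelTerm M.transport M.op (m + 1) s t (fun k W => ∑' j, G j k W) Z =
        ∫ τ in (0 : ℝ)..t, M.transport s (t - τ) (M.op s (U τ)) Z := by
      rw [duhamelTerm_succ, hU]
    simpa only [hL, hR] using hstep

/-- **Countable additivity of the Duhamel terms of the grand-canonical hierarchy in the data**
(`HierarchyModel.hasSum_duhamelTerm` for `gcHierarchyModel`, whose collision operators are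
countably additive by `hasSum_gcOutOp`). [folklore] -/
theorem hasSum_duhamelTerm_gc {ε : ℝ} (hε' : ε < 2⁻¹) {G : ℕ → GCState d (UnitAddTorus d)}
    (hGm : ∀ j k, Measurable (G j k)) {B : ℕ → ℕ → ℝ} {β : ℝ} (hβ : 0 < β)
    (hB0 : ∀ j k, 0 ≤ B j k) (hGb : ∀ j k Z, |G j k Z| ≤ B j k * exp (-β * configEnergy Z))
    (hBs : ∀ k, Summable fun j => B j k) (m s : ℕ) {t : ℝ} (ht : 0 ≤ t) (Z : Config s d (UnitAddTorus d)) :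
    HasSum (fun j => duhamelTerm (gcHierarchyModel (d := d) hε').transport (gcHierarchyModel hε').op m s t (G j) Z)
      (duhamelTerm (gcHierarchyModel (d := d) hε').transport (gcHierarchyModel hε').op m s t
        (fun k W => ∑' j, G j k W) Z) :=
  (gcHierarchyModel (d := d) hε').hasSum_duhamelTerm
    (fun _ _ _ _ hb hum hK0 hub hK Zs =>
      hasSum_gcOutOp (G := Torus.geometry d) Torus.isMeasurable_geometry ε hb hum hK0 hub hK Zs)
    hGm hβ hB0 hGb hBs m s ht Z

end TermSum

end

end Literature.MathematicalPhysics.KineticTheory
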